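import Summits.HodgeConjecture.CorCM.IrreducibleOddWeightsHodgeGluing
import Summits.HodgeConjecture.CorCM.IrreducibleOddWeightsAdditivityHellyCMFields
import HarnessLib

/-!
# Hodge gluing decided on SMALL sub-products: if every product of at most `q + 1` of the `A_i` has
# `Hg(∏_T A_i) = ∏_T Hg(A_i)` (`q ≥ max dim A_i`, or `q = [Gal(L/ℚ) : A]` for an abelian `A`, or `q = 1` for abelian
# CM fields), then the Hodge conjecture for the powers of the `A_i` gives it for every `∏_j A_{π j}`

COR-CM (cell `pub-hodgecm2`, binder seat `b16` gen 60, count-neutral claim HODGE GLUING, file G4 — CM fields and their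
realisations; theorems only, no definition, no named fact, no `sorry`).  NEW as stated, hence under `Summits/`.  HONEST
FRAMING: unconditional reductions between instances of the Hodge conjecture for CM abelian varieties (the Hodge conjecture
for the powers of the members is a HYPOTHESIS); `HC_CM` is neither used nor asserted.

The gluing theorem of G3 (`hodgeConjectureFor_biproduct_of_cmFamilyRank_add_card_eq`: `Hg(∏_i A_i) = ∏_i Hg(A_i)` +
HC for the powers of the members ⟹ HC for every product of copies) composed with the Helly numbers of additivity (gen 59,
`IrreducibleOddWeightsAdditivityHellyCMFields`: additivity of the whole family is decided on sub-families of at most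
`q + 1` members):

* **`hodgeConjectureFor_biproduct_of_forall_card_le_of_finrank_le_of_powSucc`** — `[K_i:ℚ] ≤ 2q` (dim A_i ≤ q) for all `i`,
  and `Hg(∏_{i∈T} A_i) = ∏_{i∈T} Hg(A_i)` for every non-empty `T` with `|T| ≤ q + 1` ⟹ gluing.  CM elliptic curves: PAIRS
  (Imai: pairwise non-isogenous); with CM surfaces: TRIPLES; threefolds: QUADRUPLES.  `…_of_cmTypeRank_le_…` (`dim MT(A_i) ≤ q+1`).
* **`hodgeConjectureFor_biproduct_of_forall_card_le_index_succ_of_powSucc`** — all `K_i ↪ L` Galois, `A ≤ Gal(L/ℚ)` with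
  pairwise commuting elements: sub-families of `≤ [Gal(L/ℚ):A] + 1` members decide.
* **`hodgeConjectureFor_biproduct_of_forall_pair_of_comm_of_powSucc`** — `L` ABELIAN: if `Hg(A_i × A_j) = Hg(A_i) × Hg(A_j)`
  for all PAIRS then HC for the powers of the members gives HC for every `∏_j A_{π j}` — arbitrary (degenerate) CM types.

## References

* [MoonenZarhin1999LowDim] B. Moonen, Yu. Zarhin, *Hodge classes on abelian varieties of low dimension*, Math. Ann.
  315 (1999), §3 (3.1).
* [Gordon1999HodgeAVSurvey] B. B. Gordon, *A survey of the Hodge conjecture for abelian varieties*, §3 Theorem (Imai,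
  Murty) with proof; 7.5–7.7.
* [Mai1989] L. Mai, *Lower bounds for the ranks of CM types*, J. Number Theory 32 (1989), §2 Prop. 1 (proof).
* [Serre1977] J.-P. Serre, *Linear Representations of Finite Groups*, GTM 42, §3.1 Cor. to Thm. 9.
-/

set_option autoImplicit false

noncomputable section

open scoped BigOperators

open CategoryTheory CategoryTheory.Limits NumberField

namespace Summit.HodgeConjecture.CorCM

open Literature.NumberTheory.ComplexMultiplication
open Literature.AlgebraicGeometry.Motives (AbelianVariety CMType)
open Literature.AlgebraicGeometry.Motives.AbelianVariety
open Literature.AlgebraicGeometry.HodgeTheory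
open Literature.AlgebraicGeometry.ComplexMultiplication (IsCMTypeRealisation)
open Literature.AlgebraicGeometry.Pohlmann1968

variable {I : Type} [Fintype I] {K : I → Type} [∀ i, Field (K i)] [∀ i, NumberField (K i)] [∀ i, IsCMField (K i)]
  {L : Type} [Field L] [NumberField L] [Normal ℚ L] {Φ : ∀ i, CMType (K i)} {A : I → AbelianVariety ℂ}
  {ιA : ∀ i, 𝓞 (K i) →+* End (A i)} {θ : ∀ i, K i →+* Module.End ℂ (complexBetti (A i).X 1)}

omit [Field L] [NumberField L] [Normal ℚ L] in
/-- **Hodge gluing decided on sub-products of at most `q + 1` factors, `dim MT(A_i) ≤ q + 1`**: arbitrary CM types with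
`cmTypeRank Φ_i ≤ q + 1`; if `Hg(∏_{i∈T} A_i) = ∏_{i∈T} Hg(A_i)` for every non-empty `T ⊆ I` with `|T| ≤ q + 1` and the
Hodge conjecture holds for the powers of every `A_i`, then it holds for every product of copies `⨁_j A_{π j}`.
[cite: MoonenZarhin1999LowDim, §3 (3.1)] [cite: Mai1989, §2 Prop. 1 (proof)] -/
theorem hodgeConjectureFor_biproduct_of_forall_card_le_of_cmTypeRank_le_of_powSucc (q : ℕ)
    (hq : ∀ i, cmTypeRank (Φ i) ≤ q + 1)
    (hT : ∀ T : Finset I, T.Nonempty → T.card ≤ q + 1 →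
      CMAlgebra.cmFamilyRank (K := fun j : (T : Set I) => K j) (fun j => Φ j) + T.card =
        (∑ j ∈ T, cmTypeRank (Φ j)) + 1)
    (hA : ∀ i, IsCMTypeRealisation (Φ i) (A i) (ιA i) (θ i))
    (hHC : ∀ (i : I) (N : ℕ), HodgeConjectureFor ((A i).powSucc N).dim ((A i).powSucc N).X)
    {J : Type} [Fintype J] [Nonempty J] (π : J → I) :
    HodgeConjectureFor (⨁ fun j => A (π j)).dim (⨁ fun j => A (π j)).X := by
  obtain ⟨j₀⟩ := ‹Nonempty J›
  haveI : Nonempty I := ⟨π j₀⟩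
  exact hodgeConjectureFor_biproduct_of_cmFamilyRank_add_card_eq
    ((cmFamilyRank_add_card_eq_iff_forall_card_le_of_cmTypeRank_le Φ q hq).2 hT) hA hHC π

omit [Field L] [NumberField L] [Normal ℚ L] in
/-- **THE DEGREE FORM: `dim A_i ≤ q` and additivity of all sub-products of at most `q + 1` factors ⟹ gluing.**  CM
fields with `[K_i:ℚ] ≤ 2q`, ARBITRARY CM types; if `Hg(∏_{i∈T} A_i) = ∏_{i∈T} Hg(A_i)` whenever `0 < |T| ≤ q + 1`, then
the Hodge conjecture for the powers of the members gives it for every `⨁_j A_{π j}`.  CM elliptic curves (`q = 1`): PAIRS —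
Imai's «pairwise non-isogenous»; curves and surfaces: TRIPLES; up to threefolds: QUADRUPLES.
[cite: Gordon1999HodgeAVSurvey, §3 Theorem (Imai, Murty) with proof, 7.5–7.7] [cite: MoonenZarhin1999LowDim, §3 (3.1)] -/
theorem hodgeConjectureFor_biproduct_of_forall_card_le_of_finrank_le_of_powSucc (q : ℕ)
    (hq : ∀ i, Module.finrank ℚ (K i) ≤ 2 * q)
    (hT : ∀ T : Finset I, T.Nonempty → T.card ≤ q + 1 →
      CMAlgebra.cmFamilyRank (K := fun j : (T : Set I) => K j) (fun j => Φ j) + T.card =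
        (∑ j ∈ T, cmTypeRank (Φ j)) + 1)
    (hA : ∀ i, IsCMTypeRealisation (Φ i) (A i) (ιA i) (θ i))
    (hHC : ∀ (i : I) (N : ℕ), HodgeConjectureFor ((A i).powSucc N).dim ((A i).powSucc N).X)
    {J : Type} [Fintype J] [Nonempty J] (π : J → I) :
    HodgeConjectureFor (⨁ fun j => A (π j)).dim (⨁ fun j => A (π j)).X := by
  obtain ⟨j₀⟩ := ‹Nonempty J›
  haveI : Nonempty I := ⟨π j₀⟩
  exact hodgeConjectureFor_biproduct_of_cmFamilyRank_add_card_eq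
    ((cmFamilyRank_add_card_eq_iff_forall_card_le_of_finrank_le Φ q hq).2 hT) hA hHC π

/-- **THE INDEX FORM**: all `K_i` embedded in a Galois number field `L ⊂ ℂ`, `A ≤ Gal(L/ℚ)` with pairwise commuting
elements; if `Hg(∏_{i∈T} A_i) = ∏_{i∈T} Hg(A_i)` whenever `0 < |T| ≤ [Gal(L/ℚ):A] + 1`, then the Hodge conjecture for the
powers of the members gives it for every `⨁_j A_{π j}` (arbitrary CM types). [cite: Serre1977, §3.1 Cor. to Thm. 9]
[cite: MoonenZarhin1999LowDim, §3 (3.1)] -/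
theorem hodgeConjectureFor_biproduct_of_forall_card_le_index_succ_of_powSucc (ι : L →+* ℂ) (e : ∀ i, K i →+* L)
    (G₀ : Subgroup (L ≃ₐ[ℚ] L)) (hG₀ : ∀ a ∈ G₀, ∀ b ∈ G₀, a * b = b * a)
    (hT : ∀ T : Finset I, T.Nonempty → T.card ≤ G₀.index + 1 →
      CMAlgebra.cmFamilyRank (K := fun j : (T : Set I) => K j) (fun j => Φ j) + T.card =
        (∑ j ∈ T, cmTypeRank (Φ j)) + 1)
    (hA : ∀ i, IsCMTypeRealisation (Φ i) (A i) (ιA i) (θ i))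
    (hHC : ∀ (i : I) (N : ℕ), HodgeConjectureFor ((A i).powSucc N).dim ((A i).powSucc N).X)
    {J : Type} [Fintype J] [Nonempty J] (π : J → I) :
    HodgeConjectureFor (⨁ fun j => A (π j)).dim (⨁ fun j => A (π j)).X := by
  obtain ⟨j₀⟩ := ‹Nonempty J›
  haveI : Nonempty I := ⟨π j₀⟩
  exact hodgeConjectureFor_biproduct_of_cmFamilyRank_add_card_eq
    ((cmFamilyRank_add_card_eq_iff_forall_card_le_index_succ ι e Φ G₀ hG₀).2 hT) hA hHC π

/-- **ABELIAN GALOIS CLOSURE: PAIRWISE GLUING IS GLUING.**  All `K_i` embedded in an ABELIAN Galois number field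
`L ⊂ ℂ`, ARBITRARY CM types `Φ_i`.  If `Hg(A_i × A_j) = Hg(A_i) × Hg(A_j)` for every pair `i ≠ j` (additivity of every
two-member sub-family), then the Hodge conjecture for the powers of the members gives it for EVERY product of copies
`⨁_j A_{π j}` — pairs decide, as for CM elliptic curves, for abelian CM fields of any degree and any (degenerate) types.
[cite: Gordon1999HodgeAVSurvey, §3 Theorem (Imai, Murty) with proof] [cite: MoonenZarhin1999LowDim, §3 (3.1)] -/
theorem hodgeConjectureFor_biproduct_of_forall_card_le_two_of_comm_of_powSucc (ι : L →+* ℂ) (e : ∀ i, K i →+* L)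
    (hL : ∀ a b : L ≃ₐ[ℚ] L, a * b = b * a)
    (hT : ∀ T : Finset I, T.Nonempty → T.card ≤ 2 →
      CMAlgebra.cmFamilyRank (K := fun j : (T : Set I) => K j) (fun j => Φ j) + T.card =
        (∑ j ∈ T, cmTypeRank (Φ j)) + 1)
    (hA : ∀ i, IsCMTypeRealisation (Φ i) (A i) (ιA i) (θ i))
    (hHC : ∀ (i : I) (N : ℕ), HodgeConjectureFor ((A i).powSucc N).dim ((A i).powSucc N).X)
    {J : Type} [Fintype J] [Nonempty J] (π : J → I) :
    HodgeConjectureFor (⨁ fun j => A (π j)).dim (⨁ fun j => A (π j)).X := by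
  obtain ⟨j₀⟩ := ‹Nonempty J›
  haveI : Nonempty I := ⟨π j₀⟩
  exact hodgeConjectureFor_biproduct_of_cmFamilyRank_add_card_eq
    ((cmFamilyRank_add_card_eq_iff_forall_card_le_two_of_comm ι e Φ hL).2 hT) hA hHC π

end Summit.HodgeConjecture.CorCM

end
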